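import Mathlib.Tactic.IntervalCases
import Literature.Combinatorics.SimpleGraph.MatchingMinor
import Literature.Combinatorics.SimpleGraph.PfaffianBipartite
import HarnessLib

/-!
# Little's theorem: `K_{3,3}` is the excluded matching minor of Pfaffian bipartite graphs

Topic `Combinatorics/SimpleGraph`; ONE named fact (Little's theorem, not proved here) + proved
corollaries and instances. Requested by the definition item `defn-IsMatchingMinor` of route
`ValiantsHypothesis/PolyaContinued` (wanted fact (ii): "`K_{3,3}` as the excluded matching minor of
Pfaffian bipartite graphs (Little 1975), stated as a named fact"; the route lists "Little1975
(bipartite `G` Pfaffian iff no `K_{3,3}` matching minor)" among the cite facts it will take as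
hypotheses), in that route's encoding, shared with `MatchingMinor.lean` and `PfaffianBipartite.lean`:
a bipartite graph with colour classes "rows" `Fin n` and "columns" `Fin n` is its EDGE SET
`G : Finset (Fin n × Fin n)` — exactly "the bipartite graph associated with a 0-1 square matrix"
of Robertson–Seymour–Thomas (a vertex for every row and every column, `r ~ c` iff the entry is
non-zero); `K_{3,3}` is `Finset.univ : Finset (Fin 3 × Fin 3)`.

**The result, as printed** (Robertson–Seymour–Thomas 1999, §1 and §4; `G` a bipartite graph,
`A` a 0-1 square matrix with associated bipartite graph `G`):

> **1.1** [Vazirani–Yannakakis]. Let `A` be a 0-1 square matrix, and let `G` be the associated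
> bipartite graph. Then `A` has a Pólya matrix if and only if `G` has a Pfaffian orientation.
>
> We say that a graph `G` *contains* a graph `H` … if some even subdivision of `H` is isomorphic
> to a central subgraph of `G`.
> **1.2** [Little]. A bipartite graph admits a Pfaffian orientation if and only if it does not
> contain `K_{3,3}`.
>
> (§4) We say that a graph `H` is *weakly contained* in a graph `G` … if `G` has a subgraph `K`
> such that `G ∖ V(K)` has a perfect matching and a graph isomorphic to `H` can be obtained from
> `K` by a sequence of bicontractions.
> **4.2.** Let `H` be a graph of maximum degree three. Then `H` is contained in a graph `G` if and
> only if it is weakly contained in `G`.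

Since `K_{3,3}` is cubic, (1.2) with (1.1) and (4.2) reads: *the 0-1 square matrix `A` has a
Pólya matrix iff its bipartite graph does not weakly contain `K_{3,3}`*. In the tree's vocabulary
"`A` has a Pólya matrix" is `IsPfaffianBipartite G` (`PfaffianBipartite.lean`,
`isPfaffianBipartite_iff_exists_det_eq_permanent`; symbolic form
`isPfaffianBipartite_iff_exists_mvPolynomial`) and "`G` weakly contains `H`" is
`IsMatchingMinor H G` (`MatchingMinor.lean`; = "`H` is a matching minor of `G`", Norine–Thomas,
Lucchesi–Murty). Little's original statement (1975) is the characterisation of *convertible*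
`(0,1)`-matrices (those admitting a Pólya matrix); McCuaig (2004, Theorem 12) prints it as: "If
`G` is a bipartite graph with a perfect matching, then `G` has a well-fitted `K_{3,3}`
bisubdivision if and only if `G` does not have an unbalanced `{−1, 1}`-edge weighting."

## Contents

* `Little1975_isPfaffianBipartite_iff_not_isMatchingMinor` — the NAMED FACT
  `∀ n (G : Finset (Fin n × Fin n)), IsPfaffianBipartite G ↔ ¬ IsMatchingMinor K_{3,3} G`
  (the printed theorem restricted to the graphs of square matrices, i.e. to balanced bipartite
  graphs with a fixed balanced bipartition, which is all the encoding expresses);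
* proved consequences for users holding `(h : Little1975_…)`: `.not_isPfaffianBipartite` (a
  `K_{3,3}` matching minor rules out every Pólya signing), `.isPfaffianBipartite` (the converse),
  `.iff_exists_mvPolynomial` (the route's inlined symbolic form: a `±1`-signing `s` with
  `det (C (s e) * X e)|_G = per (X e)|_G = PM_G` exists iff no `K_{3,3}` matching minor, over any
  commutative ring with `2 ≠ 0`);
* proved INSTANCES of the fact (unconditional): `G = K_{3,3}` itself
  (`isPfaffianBipartite_iff_not_isMatchingMinor_univ_fin_three`: both sides are false, by
  `not_isPfaffianBipartite_univ_fin_three` and `IsMatchingMinor.refl`), and every `G ⊆ K_{n,n}`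
  with `n ≤ 2` (`isPfaffianBipartite_iff_not_isMatchingMinor_of_lt_three`: both sides are true),
  with the size bookkeeping `Bicontracts.le`, `IsCentralSubgraph.le`, `IsMatchingMinor.le`
  (a matching minor has at most as many rows as its host) and `isPfaffianBipartite_of_lt_three`.

## Design notes / what is NOT here

* The fact is a `def … : Prop` (D-0014), to be taken as a hypothesis `(h : Little1975_…)`; its
  eventual proof (`theorem Little1975_…_holds`) is a literature-prover task. The "easy" direction
  (a `K_{3,3}` matching minor of `G` forbids Pólya signings: Pfaffian-ness descends to central
  subgraphs and along bicontractions, and `K_{3,3}` is not Pfaffian —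
  `not_isPfaffianBipartite_univ_fin_three`) is within reach of the tree; the "difficult" direction
  is Little's theorem proper (McCuaig 2004 §10 derives it from the brace structure theorem).
* NOT here: Pfaffian orientations and (1.1) itself, even subdivisions / "containment" and (4.2)
  itself (only their conjunction with (1.2) is vendored, in the two notions the tree has); the
  Robertson–Seymour–Thomas / McCuaig structure theorem (Pfaffian braces = planar braces, the
  Heawood graph, 4-cycle sums) and the polynomial-time algorithm; unbalanced bipartite graphs.
* `lean search 'Little|K33|excluded.?minor|weaklyContain'` (declarations): nothing relevant in
  Mathlib or the tree besides `MatchingMinor.lean` / `PfaffianBipartite.lean`.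

## References

* C. H. C. Little, *A characterization of convertible (0,1)-matrices*, J. Combin. Theory Ser. B
  18 (1975) 187–208. [Little1975]
* N. Robertson, P. D. Seymour, R. Thomas, *Permanents, Pfaffian orientations, and even directed
  circuits*, Ann. of Math. 150 (1999) 929–975 (arXiv:math/9911268): (1.1), (1.2), §4 (weak
  containment), (4.2). [RobertsonSeymourThomas1999]
* W. McCuaig, *Pólya's permanent problem*, Electron. J. Combin. 11 (2004) R79, Theorem 12 and §10.
  [McCuaig2004]
* V. V. Vazirani, M. Yannakakis, *Pfaffian orientations, 0-1 permanents, and even cycles in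
  directed graphs*, Discrete Appl. Math. 25 (1989) 179–190. [VaziraniYannakakis1989]
-/

namespace Literature.Combinatorics.SimpleGraph

/-! ### The named fact -/

/-- **Little's theorem, matching-minor form** (named fact, not proved here). For every `n` and
every bipartite graph `G ⊆ K_{n,n}` in the edge-set encoding (the bipartite graph of an `n × n`
0-1 matrix `A`): `A` has a Pólya matrix — some 1's of `A` can be changed to −1's so that the
determinant becomes the permanent, `IsPfaffianBipartite G` — if and only if `G` does not weakly
contain `K_{3,3}`, i.e. `K_{3,3} = Finset.univ ⊆ Fin 3 × Fin 3` is not a matching minor of `G`.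
This is Robertson–Seymour–Thomas (1.2) [Little 1975: "A bipartite graph admits a Pfaffian
orientation if and only if it does not contain `K_{3,3}`"] combined with (1.1)
[Vazirani–Yannakakis: `A` has a Pólya matrix iff `G` has a Pfaffian orientation] and (4.2) [for
`H` of maximum degree three, `H` is contained in `G` iff it is weakly contained in `G`],
specialised to the bipartite graphs of square matrices.
[cite: RobertsonSeymourThomas1999, (1.2) with (1.1) and (4.2)] -/
def Little1975_isPfaffianBipartite_iff_not_isMatchingMinor : Prop :=
  ∀ {n : ℕ} (G : Finset (Fin n × Fin n)),
    IsPfaffianBipartite G ↔ ¬ IsMatchingMinor (Finset.univ : Finset (Fin 3 × Fin 3)) G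

/-! ### Consequences for users of the fact -/

/-- Little's theorem, "easy" direction as used: a bipartite graph with a `K_{3,3}` matching minor
has no Pólya signing. [cite: RobertsonSeymourThomas1999, (1.2) with (1.1) and (4.2)] -/
theorem Little1975_isPfaffianBipartite_iff_not_isMatchingMinor.not_isPfaffianBipartite
    (h : Little1975_isPfaffianBipartite_iff_not_isMatchingMinor) {n : ℕ}
    {G : Finset (Fin n × Fin n)} (hG : IsMatchingMinor (Finset.univ : Finset (Fin 3 × Fin 3)) G) :
    ¬ IsPfaffianBipartite G :=
  fun hP => (h G).mp hP hG

/-- Little's theorem, "difficult" direction as used: a bipartite graph (of a square matrix) without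
a `K_{3,3}` matching minor is Pfaffian. [cite: RobertsonSeymourThomas1999, (1.2) with (1.1) and (4.2)] -/
theorem Little1975_isPfaffianBipartite_iff_not_isMatchingMinor.isPfaffianBipartite
    (h : Little1975_isPfaffianBipartite_iff_not_isMatchingMinor) {n : ℕ}
    {G : Finset (Fin n × Fin n)} (hG : ¬ IsMatchingMinor (Finset.univ : Finset (Fin 3 × Fin 3)) G) :
    IsPfaffianBipartite G :=
  (h G).mpr hG

/-- Little's theorem in the SYMBOLIC form inlined by route `PolyaContinued` (there `R = ℂ`): over a
commutative ring with `2 ≠ 0`, a `±1`-signing `s` of the symbolic biadjacency matrix with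
`det (C (s e) * X e)|_G = per (X e)|_G` (`= PM_G`) exists iff `K_{3,3}` is not a matching minor of
`G` (the fact composed with `isPfaffianBipartite_iff_exists_mvPolynomial`).
[cite: RobertsonSeymourThomas1999, (1.2) with (1.1) and (4.2)] -/
theorem Little1975_isPfaffianBipartite_iff_not_isMatchingMinor.exists_mvPolynomial_iff
    (h : Little1975_isPfaffianBipartite_iff_not_isMatchingMinor) {R : Type*} [CommRing R]
    (h2 : (2 : R) ≠ 0) {n : ℕ} (G : Finset (Fin n × Fin n)) :
    (∃ s : Fin n × Fin n → R, (∀ e, s e = 1 ∨ s e = -1) ∧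
      (Matrix.of fun i j => if (i, j) ∈ G then MvPolynomial.C (s (i, j)) * MvPolynomial.X (i, j)
        else 0 : Matrix (Fin n) (Fin n) (MvPolynomial (Fin n × Fin n) R)).det =
      (Matrix.of fun i j => if (i, j) ∈ G then MvPolynomial.X (i, j)
        else 0 : Matrix (Fin n) (Fin n) (MvPolynomial (Fin n × Fin n) R)).permanent) ↔
      ¬ IsMatchingMinor (Finset.univ : Finset (Fin 3 × Fin 3)) G := by
  rw [← isPfaffianBipartite_iff_exists_mvPolynomial G h2]
  exact h G

/-! ### Unconditional instances -/

/-- **The instance `G = K_{3,3}` of Little's theorem holds**: `K_{3,3}` is not Pfaffian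
(`not_isPfaffianBipartite_univ_fin_three`, Pólya 1913 / Robertson–Seymour–Thomas (6.2)) and is a
matching minor of itself. [folklore] -/
theorem isPfaffianBipartite_iff_not_isMatchingMinor_univ_fin_three :
    IsPfaffianBipartite (Finset.univ : Finset (Fin 3 × Fin 3)) ↔
      ¬ IsMatchingMinor (Finset.univ : Finset (Fin 3 × Fin 3))
        (Finset.univ : Finset (Fin 3 × Fin 3)) :=
  iff_of_false not_isPfaffianBipartite_univ_fin_three (not_not_intro (IsMatchingMinor.refl _))

/-- A bicontraction sequence never increases the number of rows: `Bicontracts G H` with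
`G ⊆ K_{n,n}`, `H ⊆ K_{m,m}` forces `m ≤ n`. [folklore] -/
theorem Bicontracts.le {n m : ℕ} {G : Finset (Fin n × Fin n)} {H : Finset (Fin m × Fin m)}
    (h : Bicontracts G H) : m ≤ n := by
  induction h with
  | of_isIsomorphic _ => exact le_rfl
  | step _ _ ih => exact ih.trans (Nat.le_succ _)

/-- A central subgraph has at most as many rows as the host: `IsCentralSubgraph K G` with
`K ⊆ K_{k,k}`, `G ⊆ K_{n,n}` forces `k ≤ n` (the rows of `K` embed). [folklore] -/
theorem IsCentralSubgraph.le {k n : ℕ} {K : Finset (Fin k × Fin k)} {G : Finset (Fin n × Fin n)}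
    (h : IsCentralSubgraph K G) : k ≤ n := by
  obtain ⟨r, -, -, -⟩ := h
  simpa using Fintype.card_le_of_embedding r

/-- A matching minor has at most as many rows as the host. [folklore] -/
theorem IsMatchingMinor.le {m n : ℕ} {H : Finset (Fin m × Fin m)} {G : Finset (Fin n × Fin n)}
    (h : IsMatchingMinor H G) : m ≤ n := by
  obtain ⟨k, K, hK, hKH⟩ := h
  exact hKH.le.trans hK.le

/-- `K_{3,3}` does not fit into fewer than three rows: if `n < 3` then `K_{3,3}` is not a matching
minor of any `G ⊆ K_{n,n}`. [folklore] -/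
theorem not_isMatchingMinor_univ_fin_three_of_lt {n : ℕ} (hn : n < 3)
    (G : Finset (Fin n × Fin n)) :
    ¬ IsMatchingMinor (Finset.univ : Finset (Fin 3 × Fin 3)) G :=
  fun h => absurd h.le (not_le.mpr hn)

/-- Every `G ⊆ K_{n,n}` with `n ≤ 2` is Pfaffian: `K_{0,0}` and `K_{1,1}` trivially (the all-`1`
signing; the only permutation is the identity), `K_{2,2}` by `isPfaffianBipartite_univ_fin_two`,
and subgraphs of Pfaffian graphs are Pfaffian. [folklore] -/
theorem isPfaffianBipartite_of_lt_three {n : ℕ} (hn : n < 3) (G : Finset (Fin n × Fin n)) :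
    IsPfaffianBipartite G := by
  have key : IsPfaffianBipartite (Finset.univ : Finset (Fin n × Fin n)) := by
    interval_cases n
    · exact ⟨fun _ => 1, fun σ _ => by simp [Subsingleton.elim σ 1]⟩
    · exact ⟨fun _ => 1, fun σ _ => by simp [Subsingleton.elim σ 1]⟩
    · exact isPfaffianBipartite_univ_fin_two
  exact key.anti (Finset.subset_univ G)

/-- **The instances `n ≤ 2` of Little's theorem hold**: for `G ⊆ K_{n,n}` with `n < 3` both sides
are true (`G` is Pfaffian, and `K_{3,3}` is too large to be a matching minor of `G`). [folklore] -/
theorem isPfaffianBipartite_iff_not_isMatchingMinor_of_lt_three {n : ℕ} (hn : n < 3)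
    (G : Finset (Fin n × Fin n)) :
    IsPfaffianBipartite G ↔ ¬ IsMatchingMinor (Finset.univ : Finset (Fin 3 × Fin 3)) G :=
  iff_of_true (isPfaffianBipartite_of_lt_three hn G)
    (not_isMatchingMinor_univ_fin_three_of_lt hn G)

end Literature.Combinatorics.SimpleGraph
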